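import Summits.HodgeConjecture.CorCM.GaloisSplitInvolutionTypes
import HarnessLib

/-!
# `(ℤ/4 × ℤ/2) ⋊ C₂` times `C_n`: the Pauli group `C₄ ∘ D₄` and `(C₄ × C₂) ⋊ C₂` with a real cyclic factor are BAD

COR-CM (cell `pub-hodgecm2`), binder seat b04 (gen 29), count-neutral own lane «Galois-CM-type classification» (which Galois CM
fields `(G, c)` have ALL primitive CM types nondegenerate = GOOD, vs. a primitive degenerate type = BAD).  KERNEL ONLY: theorems;
no definition, no named fact, no `sorry`.  `HC_CM` is neither used nor claimed.

SETTING.  The two non-abelian groups of order `16` that are SPLIT extensions of `A = ℤ/4 × ℤ/2` by an involution `ξ` acting through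
an automorphism `f` of `A` other than `±1`: the PAULI group `C₄ ∘ D₄` (`f(t,s) = (t + 2s, s)`, unique central involution `(2,0)`;
GOOD on its own, gen 17 census `CorCM/GaloisSixteenClassification`) and `(C₄ × C₂) ⋊ C₂` = SmallGroup(16,3)
(`f(t,s) = (t, s + t mod 2)`, three central involutions `(2,0), (0,1), (2,1)`; BAD on its own for each).  Uniform presentation
`Multiplicative (ZMod 4 × ZMod 2) ⋊[φ] Multiplicative (ZMod 2)` with `φ(1) = f` (read additively through a plain function
`f : ℤ/4 × ℤ/2 → ℤ/4 × ℤ/2`), times `C_n`, complex conjugation `c = (c₀, 1)`, `c₀ ∈ A` with `f c₀ = c₀`.  This is the situation of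
the SPLIT-INVOLUTION THEOREM (`CorCM/GaloisSplitInvolutionTypes`): `x = (ξ, 1)`, `x² = 1`, `θ = (f, id)` on `A × ℤ/n`; the DOUBLED
TYPE of an aperiodic `θ`-asymmetric CM half is PRIMITIVE and DEGENERATE.
* §1 `exists_simple_degenerate_fourTwo_semidirect_times_cyclic_of_half`: the theorem for this presentation, any `f`, `c₀`, `n`,
  with the half supplied as a decidable predicate on `(ℤ/4 × ℤ/2) × ℤ/n`.
* §2 INSTANCES by `decide` (`n = 3`; the halves were found by a 2-line search, `scratch-g29/half16c.py`):
  **`(C₄ ∘ D₄) × C₃` (order 48) is BAD** (`…_pauli_cyclicThree`; also `× C₅`, order 80) — the Pauli CM field of degree 16 is GOOD, a real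
  cubic (quintic) cyclic factor spoils it; **`((C₄ × C₂) ⋊ C₂) × C₃` is BAD for each of its three central involutions**
  (`…_fourTwoSemidirect_cyclicThree`).  Halves: `t − 2·𝟙_{(s,v)=(1,1)} ∈ {0,1}` for `c₀ = (2,0)`; `s = 0 ⟺ (v = 1 ∧ t = 0)` for
  `c₀ = (0,1)`; `s = 0 ⟺ (v = 1 ∧ t + 2s = 0)` for `c₀ = (2,1)`.
With `CorCM/GaloisDihedralTimesCyclicDegenerate` (`D₄ × C_n`), `CorCM/GaloisSemidihedralModularTimesCyclicDegenerate` (`D₈`, `SD₁₆`,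
`M₁₆`) and gen 24's real-factor theorems (`D₄ × C₂`, `Q₈ × C₂` with `c` off the quaternion/dihedral factor), every non-abelian
`Γ` of order `16` on the EASY side of the index-two dichotomy (`CorCM/GaloisIndexTwoDoubledTypes`: some `x ∉ A` with `c ∉ ⟨x²⟩`)
now has `Γ × C₃` BAD in the tree; the HARD side (`Q₁₆`, `Q₈ × C₂` with `c = a²`: `c ∈ ⟨x²⟩` for all `x ∉ A`) is norm-pair arithmetic.

## References

* [Kubota1965] T. Kubota, *On the field extension by complex multiplication*, Trans. AMS 118 (1965), §2, §4 Lemma 2.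
* [Shimura1998] G. Shimura, *Abelian Varieties with Complex Multiplication and Modular Functions*, §6.2 Thm. 3, §8.2 Prop. 26.
* [Gordon1999HodgeAVSurvey] B. B. Gordon, *A survey of the Hodge conjecture for abelian varieties*, Thm. 6.4, §9.3.
-/

noncomputable section

open CategoryTheory CategoryTheory.Limits NumberField
open scoped BigOperators

namespace Summit.HodgeConjecture.CorCM.SplitInvolution

open Literature.NumberTheory.ComplexMultiplication
open Literature.AlgebraicGeometry.Motives (AbelianVariety CMType)
open Literature.AlgebraicGeometry.HodgeTheory
open Literature.AlgebraicGeometry.ComplexMultiplication (IsCMTypeRealisation)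
open Literature.AlgebraicGeometry.Pohlmann1968
open Literature.Barriers.HodgeConjecture (divisorClassesSpan)

/-! ## §1 The split-involution theorem for `((ℤ/4 × ℤ/2) ⋊_f C₂) × C_n` -/

section Field

variable {K : Type} [Field K] [NumberField K] [IsCMField K] [IsGalois ℚ K]

/-- **`Gal(K/ℚ) ≅ ((ℤ/4 × ℤ/2) ⋊_f C₂) × C_n`** (`φ(1) = f` read additively), complex conjugation `(c₀, 1)` with `c₀ ≠ 0`, `2c₀ = 0`,
`f c₀ = c₀`, with an aperiodic `θ`-asymmetric CM half of `(ℤ/4 × ℤ/2) × ℤ/n` (`θ = (f, id)`, half given as a decidable predicate)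
⟹ **BAD**: a simple DEGENERATE abelian variety of dimension `8n` with CM by `K` (doubled type under the split involution `(ξ, 1)`).
[cite: Kubota1965, §2 and §4 Lemma 2] [cite: Shimura1998, §6.2 Thm. 3 and §8.2 Prop. 26] [cite: Gordon1999HodgeAVSurvey, Thm. 6.4 and §9.3] -/
theorem exists_simple_degenerate_fourTwo_semidirect_times_cyclic_of_half {n : ℕ} [NeZero n]
    (f : ZMod 4 × ZMod 2 → ZMod 4 × ZMod 2) (φ : Multiplicative (ZMod 2) →* MulAut (Multiplicative (ZMod 4 × ZMod 2)))
    (hφ : ∀ w, Multiplicative.toAdd (φ (Multiplicative.ofAdd 1) w) = f (Multiplicative.toAdd w))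
    (c₀ : ZMod 4 × ZMod 2) (hc₀ : c₀ ≠ 0) (h2c₀ : c₀ + c₀ = 0) (hfc : f c₀ = c₀)
    (e : (K ≃ₐ[ℚ] K) ≃* (Multiplicative (ZMod 4 × ZMod 2) ⋊[φ] Multiplicative (ZMod 2)) × Multiplicative (ZMod n))
    (hc : e ((IsCMField.complexConj K).restrictScalars ℚ) = (SemidirectProduct.inl (Multiplicative.ofAdd c₀), 1))
    (P : (ZMod 4 × ZMod 2) × ZMod n → Prop) [DecidablePred P] (hP : ∀ s, P s ↔ ¬ P ((c₀, 0) + s))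
    (haper : ∀ a : (ZMod 4 × ZMod 2) × ZMod n, a ≠ 0 → ∃ s, ¬ (P s ↔ P (a + s)))
    (hasym : ∀ a : (ZMod 4 × ZMod 2) × ZMod n, ∃ s, ¬ (P s ↔ P (a + (f s.1, s.2)))) :
    ∃ (Φ : CMType K) (φ₀ : K →+* ℂ) (X : AbelianVariety ℂ) (ι : 𝓞 K →+* End X)
      (ϑ : K →+* Module.End ℂ (complexBetti X.X 1)),
      IsPrimitive (ℂ ≃+* ℂ) Φ.1 φ₀ ∧ ¬ IsNondegenerate Φ ∧ IsCMTypeRealisation Φ X ι ϑ ∧ X.IsSimple ∧ X.dim = 8 * n ∧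
      ∃ m q : ℕ, ∃ y : complexBetti (⨁ fun _ : Fin m => X).X (2 * q), IsRationalClass y ∧
        IsOfHodgeType (⨁ fun _ : Fin m => X).dim (⨁ fun _ : Fin m => X).X (2 * q) q q y ∧
        y ∉ divisorClassesSpan (⨁ fun _ : Fin m => X).X (⨁ fun _ : Fin m => X).dim q := by
  classical
  haveI : Fintype (Multiplicative (ZMod 4 × ZMod 2) ⋊[φ] Multiplicative (ZMod 2)) :=
    Fintype.ofEquiv _ SemidirectProduct.equivProd.symm
  have hcard : Fintype.card (Multiplicative (ZMod 4 × ZMod 2) ⋊[φ] Multiplicative (ZMod 2)) = 16 := by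
    rw [Fintype.card_congr SemidirectProduct.equivProd, Fintype.card_prod, Fintype.card_multiplicative,
      Fintype.card_multiplicative, Fintype.card_prod, ZMod.card, ZMod.card]
  set g₁ : Multiplicative (ZMod 2) := Multiplicative.ofAdd 1 with hg₁_def
  have hg₁ : g₁ * g₁ = 1 := by rw [hg₁_def, ← ofAdd_add]; rfl
  let i : Multiplicative (ZMod 4 × ZMod 2) × Multiplicative (ZMod n) →*
      (Multiplicative (ZMod 4 × ZMod 2) ⋊[φ] Multiplicative (ZMod 2)) × Multiplicative (ZMod n) :=
    MonoidHom.prodMap SemidirectProduct.inl (MonoidHom.id _)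
  have hi_apply : ∀ t v, i (t, v) = (SemidirectProduct.inl t, v) := fun t v => rfl
  have hi : Function.Injective i := by
    rintro ⟨t, v⟩ ⟨t', v'⟩ h
    simp only [hi_apply, Prod.mk.injEq, SemidirectProduct.inl_inj] at h
    exact Prod.ext h.1 h.2
  set x : (Multiplicative (ZMod 4 × ZMod 2) ⋊[φ] Multiplicative (ZMod 2)) × Multiplicative (ZMod n) :=
    (SemidirectProduct.inr g₁, 1) with hx_def
  have hg₁1 : g₁ ≠ 1 := by rw [hg₁_def]; decide
  have hx : ∀ w, i w ≠ x := fun ⟨t, v⟩ h => by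
    have h1 := congrArg (fun z => SemidirectProduct.right z.1) h
    simp only [hi_apply, hx_def, SemidirectProduct.right_inl, SemidirectProduct.right_inr] at h1
    exact hg₁1 h1.symm
  have hcov : ∀ g : (Multiplicative (ZMod 4 × ZMod 2) ⋊[φ] Multiplicative (ZMod 2)) × Multiplicative (ZMod n),
      (∃ w, g = i w) ∨ (∃ w, g = i w * x) := by
    rintro ⟨⟨t, g₂⟩, v⟩
    rcases (by decide : ∀ z : Multiplicative (ZMod 2), z = 1 ∨ z = Multiplicative.ofAdd 1) g₂ with h | h
    · exact Or.inl ⟨(t, v), by rw [h]; rfl⟩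
    · refine Or.inr ⟨(t, v), ?_⟩
      rw [h, hi_apply, hx_def, Prod.mk_mul_mk, mul_one, ← hg₁_def, SemidirectProduct.mk_eq_inl_mul_inr]
  let θ : Multiplicative (ZMod 4 × ZMod 2) × Multiplicative (ZMod n) ≃*
      Multiplicative (ZMod 4 × ZMod 2) × Multiplicative (ZMod n) :=
    MulEquiv.prodCongr (φ g₁) (MulEquiv.refl _)
  have hθ_apply : ∀ w, θ w = (Multiplicative.ofAdd (f (Multiplicative.toAdd w.1)), w.2) := fun w => by
    change ((φ g₁) w.1, w.2) = _
    refine Prod.ext ?_ rfl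
    change (φ g₁) w.1 = _
    rw [← hφ, ofAdd_toAdd]
  have hθ : ∀ w, x * i w = i (θ w) * x := fun ⟨t, v⟩ => by
    rw [hi_apply, hx_def, Prod.mk_mul_mk, one_mul, Prod.mk_mul_mk, mul_one]
    refine Prod.ext ?_ rfl
    change SemidirectProduct.inr g₁ * SemidirectProduct.inl t = SemidirectProduct.inl ((φ g₁) t) * SemidirectProduct.inr g₁
    rw [SemidirectProduct.inl_aut, map_inv, inv_mul_cancel_right]
  have hxx : x * x = 1 := by
    rw [hx_def, Prod.mk_mul_mk, mul_one, ← map_mul, hg₁, map_one]; rfl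
  set c : Multiplicative (ZMod 4 × ZMod 2) × Multiplicative (ZMod n) := (Multiplicative.ofAdd c₀, 1) with hc_def
  have hic : i c = (SemidirectProduct.inl (Multiplicative.ofAdd c₀), 1) := rfl
  have hc1 : c ≠ 1 := by
    rw [hc_def]
    exact fun h => hc₀ (by simpa using congrArg (fun z => Multiplicative.toAdd z.1) h)
  have hcc : c * c = 1 := by
    rw [hc_def, Prod.mk_mul_mk, mul_one, ← ofAdd_add, h2c₀, ofAdd_zero]; rfl
  have hθc : θ c = c := by
    rw [hθ_apply, hc_def]
    exact Prod.ext (by rw [toAdd_ofAdd, hfc]) rfl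
  set S : Finset (Multiplicative (ZMod 4 × ZMod 2) × Multiplicative (ZMod n)) :=
    Finset.univ.filter fun w => P (Multiplicative.toAdd w.1, Multiplicative.toAdd w.2) with hS_def
  have hSmem : ∀ w : Multiplicative (ZMod 4 × ZMod 2) × Multiplicative (ZMod n),
      w ∈ S ↔ P (Multiplicative.toAdd w.1, Multiplicative.toAdd w.2) := fun w => by simp [hS_def]
  have hS : ∀ a, a ∈ S ↔ c * a ∉ S := fun a => by
    rw [hSmem, hSmem, hc_def, Prod.fst_mul, Prod.snd_mul, one_mul, toAdd_mul, toAdd_ofAdd, hP]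
    simp only [Prod.mk_add_mk, zero_add]
  have haper' : ∀ a : Multiplicative (ZMod 4 × ZMod 2) × Multiplicative (ZMod n), a ≠ 1 → ∃ s, ¬ (s ∈ S ↔ a * s ∈ S) := by
    intro a ha
    have ha' : (Multiplicative.toAdd a.1, Multiplicative.toAdd a.2) ≠ (0 : (ZMod 4 × ZMod 2) × ZMod n) := by
      intro h
      apply ha
      rw [Prod.mk_eq_zero] at h
      exact Prod.ext (toAdd_eq_zero.1 h.1) (toAdd_eq_zero.1 h.2)
    obtain ⟨⟨s₁, s₂⟩, hs⟩ := haper _ ha'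
    refine ⟨(Multiplicative.ofAdd s₁, Multiplicative.ofAdd s₂), ?_⟩
    simpa only [hSmem, Prod.fst_mul, Prod.snd_mul, toAdd_mul, toAdd_ofAdd, Prod.mk_add_mk] using hs
  have hasym' : ∀ a : Multiplicative (ZMod 4 × ZMod 2) × Multiplicative (ZMod n), ∃ s, ¬ (s ∈ S ↔ a * θ s ∈ S) := by
    intro a
    obtain ⟨⟨s₁, s₂⟩, hs⟩ := hasym (Multiplicative.toAdd a.1, Multiplicative.toAdd a.2)
    refine ⟨(Multiplicative.ofAdd s₁, Multiplicative.ofAdd s₂), ?_⟩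
    simpa only [hSmem, hθ_apply, Prod.fst_mul, Prod.snd_mul, toAdd_mul, toAdd_ofAdd, Prod.mk_add_mk] using hs
  obtain ⟨Φ, φ₀, X, ι, ϑ, h1, h2, h3, h4, h5, h6⟩ := exists_simple_degenerate_of_split_involution e i hi x hx hcov θ hθ hxx hc1
    hcc hθc (by rw [hic]; exact hc) S hS haper' hasym'
  refine ⟨Φ, φ₀, X, ι, ϑ, h1, h2, h3, h4, ?_, h6⟩
  rw [h5, Fintype.card_prod, hcard, Fintype.card_multiplicative, ZMod.card]
  omega

/-! ## §2 Instances: the Pauli group and `(C₄ × C₂) ⋊ C₂`, times `C₃` (and `C₅`) -/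

/-- **`(C₄ ∘ D₄) × C₃` (Pauli group times `C₃`, order 48, complex conjugation `((2,0), 1)`) is BAD** — doubled type of the half
`t − 2·𝟙_{(s,v)=(1,1)} ∈ {0,1}`; the Pauli CM field of degree 16 alone is GOOD (gen 17).
[cite: Shimura1998, §6.2 Thm. 3 and §8.2 Prop. 26] [cite: Gordon1999HodgeAVSurvey, Thm. 6.4 and §9.3] -/
theorem exists_simple_degenerate_pauli_cyclicThree (φ : Multiplicative (ZMod 2) →* MulAut (Multiplicative (ZMod 4 × ZMod 2)))
    (hφ : ∀ w, Multiplicative.toAdd (φ (Multiplicative.ofAdd 1) w) =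
      ((Multiplicative.toAdd w).1 + 2 * ((Multiplicative.toAdd w).2.val : ZMod 4), (Multiplicative.toAdd w).2))
    (e : (K ≃ₐ[ℚ] K) ≃* (Multiplicative (ZMod 4 × ZMod 2) ⋊[φ] Multiplicative (ZMod 2)) × Multiplicative (ZMod 3))
    (hc : e ((IsCMField.complexConj K).restrictScalars ℚ) = (SemidirectProduct.inl (Multiplicative.ofAdd (2, 0)), 1)) :
    ∃ (Φ : CMType K) (φ₀ : K →+* ℂ) (X : AbelianVariety ℂ) (ι : 𝓞 K →+* End X)
      (ϑ : K →+* Module.End ℂ (complexBetti X.X 1)),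
      IsPrimitive (ℂ ≃+* ℂ) Φ.1 φ₀ ∧ ¬ IsNondegenerate Φ ∧ IsCMTypeRealisation Φ X ι ϑ ∧ X.IsSimple ∧ X.dim = 8 * 3 ∧
      ∃ m q : ℕ, ∃ y : complexBetti (⨁ fun _ : Fin m => X).X (2 * q), IsRationalClass y ∧
        IsOfHodgeType (⨁ fun _ : Fin m => X).dim (⨁ fun _ : Fin m => X).X (2 * q) q q y ∧
        y ∉ divisorClassesSpan (⨁ fun _ : Fin m => X).X (⨁ fun _ : Fin m => X).dim q :=
  exists_simple_degenerate_fourTwo_semidirect_times_cyclic_of_half (fun w => (w.1 + 2 * (w.2.val : ZMod 4), w.2)) φ hφ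
    (2, 0) (by decide) (by decide) (by decide) e hc
    (fun s => (s.1.1 - if s.1.2 = 1 ∧ s.2 = 1 then 2 else 0).val < 2) (by decide) (by decide) (by decide)

/-- **`(C₄ ∘ D₄) × C₅` (order 80) is BAD** (same half). [cite: Shimura1998, §6.2 Thm. 3 and §8.2 Prop. 26]
[cite: Gordon1999HodgeAVSurvey, Thm. 6.4 and §9.3] -/
theorem exists_simple_degenerate_pauli_cyclicFive (φ : Multiplicative (ZMod 2) →* MulAut (Multiplicative (ZMod 4 × ZMod 2)))
    (hφ : ∀ w, Multiplicative.toAdd (φ (Multiplicative.ofAdd 1) w) =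
      ((Multiplicative.toAdd w).1 + 2 * ((Multiplicative.toAdd w).2.val : ZMod 4), (Multiplicative.toAdd w).2))
    (e : (K ≃ₐ[ℚ] K) ≃* (Multiplicative (ZMod 4 × ZMod 2) ⋊[φ] Multiplicative (ZMod 2)) × Multiplicative (ZMod 5))
    (hc : e ((IsCMField.complexConj K).restrictScalars ℚ) = (SemidirectProduct.inl (Multiplicative.ofAdd (2, 0)), 1)) :
    ∃ (Φ : CMType K) (φ₀ : K →+* ℂ) (X : AbelianVariety ℂ) (ι : 𝓞 K →+* End X)
      (ϑ : K →+* Module.End ℂ (complexBetti X.X 1)),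
      IsPrimitive (ℂ ≃+* ℂ) Φ.1 φ₀ ∧ ¬ IsNondegenerate Φ ∧ IsCMTypeRealisation Φ X ι ϑ ∧ X.IsSimple ∧ X.dim = 8 * 5 ∧
      ∃ m q : ℕ, ∃ y : complexBetti (⨁ fun _ : Fin m => X).X (2 * q), IsRationalClass y ∧
        IsOfHodgeType (⨁ fun _ : Fin m => X).dim (⨁ fun _ : Fin m => X).X (2 * q) q q y ∧
        y ∉ divisorClassesSpan (⨁ fun _ : Fin m => X).X (⨁ fun _ : Fin m => X).dim q :=
  exists_simple_degenerate_fourTwo_semidirect_times_cyclic_of_half (fun w => (w.1 + 2 * (w.2.val : ZMod 4), w.2)) φ hφ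
    (2, 0) (by decide) (by decide) (by decide) e hc
    (fun s => (s.1.1 - if s.1.2 = 1 ∧ s.2 = 1 then 2 else 0).val < 2) (by decide) (by decide) (by decide)

/-- **`((C₄ × C₂) ⋊ C₂) × C₃` (SmallGroup(16,3) times `C₃`, order 48) is BAD for EACH of its three central involutions
`c₀ ∈ {(2,0), (0,1), (2,1)}`** — doubled types of the halves `t − 2·𝟙_{(s,v)=(1,1)} ∈ {0,1}`, `s = 0 ⟺ (v = 1 ∧ t = 0)`,
`s = 0 ⟺ (v = 1 ∧ t + 2s = 0)` respectively. [cite: Shimura1998, §6.2 Thm. 3 and §8.2 Prop. 26] [cite: Gordon1999HodgeAVSurvey, Thm. 6.4 and §9.3] -/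
theorem exists_simple_degenerate_fourTwoSemidirect_cyclicThree
    (φ : Multiplicative (ZMod 2) →* MulAut (Multiplicative (ZMod 4 × ZMod 2)))
    (hφ : ∀ w, Multiplicative.toAdd (φ (Multiplicative.ofAdd 1) w) =
      ((Multiplicative.toAdd w).1, (Multiplicative.toAdd w).2 + ((Multiplicative.toAdd w).1.val : ZMod 2)))
    (c₀ : ZMod 4 × ZMod 2) (hc₀ : c₀ = (2, 0) ∨ c₀ = (0, 1) ∨ c₀ = (2, 1))
    (e : (K ≃ₐ[ℚ] K) ≃* (Multiplicative (ZMod 4 × ZMod 2) ⋊[φ] Multiplicative (ZMod 2)) × Multiplicative (ZMod 3))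
    (hc : e ((IsCMField.complexConj K).restrictScalars ℚ) = (SemidirectProduct.inl (Multiplicative.ofAdd c₀), 1)) :
    ∃ (Φ : CMType K) (φ₀ : K →+* ℂ) (X : AbelianVariety ℂ) (ι : 𝓞 K →+* End X)
      (ϑ : K →+* Module.End ℂ (complexBetti X.X 1)),
      IsPrimitive (ℂ ≃+* ℂ) Φ.1 φ₀ ∧ ¬ IsNondegenerate Φ ∧ IsCMTypeRealisation Φ X ι ϑ ∧ X.IsSimple ∧ X.dim = 8 * 3 ∧
      ∃ m q : ℕ, ∃ y : complexBetti (⨁ fun _ : Fin m => X).X (2 * q), IsRationalClass y ∧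
        IsOfHodgeType (⨁ fun _ : Fin m => X).dim (⨁ fun _ : Fin m => X).X (2 * q) q q y ∧
        y ∉ divisorClassesSpan (⨁ fun _ : Fin m => X).X (⨁ fun _ : Fin m => X).dim q := by
  rcases hc₀ with rfl | rfl | rfl
  · exact exists_simple_degenerate_fourTwo_semidirect_times_cyclic_of_half
      (fun w => (w.1, w.2 + (w.1.val : ZMod 2))) φ hφ (2, 0) (by decide) (by decide) (by decide) e hc
      (fun s => (s.1.1 - if s.1.2 = 1 ∧ s.2 = 1 then 2 else 0).val < 2) (by decide) (by decide) (by decide)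
  · exact exists_simple_degenerate_fourTwo_semidirect_times_cyclic_of_half
      (fun w => (w.1, w.2 + (w.1.val : ZMod 2))) φ hφ (0, 1) (by decide) (by decide) (by decide) e hc
      (fun s => s.1.2 = 0 ↔ (s.2 = 1 ∧ s.1.1 = 0)) (by decide) (by decide) (by decide)
  · exact exists_simple_degenerate_fourTwo_semidirect_times_cyclic_of_half
      (fun w => (w.1, w.2 + (w.1.val : ZMod 2))) φ hφ (2, 1) (by decide) (by decide) (by decide) e hc
      (fun s => s.1.2 = 0 ↔ (s.2 = 1 ∧ s.1.1 + 2 * (s.1.2.val : ZMod 4) = 0)) (by decide) (by decide) (by decide)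

end Field

end Summit.HodgeConjecture.CorCM.SplitInvolution

end
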